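import Literature.Analysis.FluidPDE.CompressibleEulerImplosionFarFieldBounds
import Literature.Analysis.FluidPDE.IsentropicEulerTorusUniqueness
import Literature.Analysis.FunctionSpaces.TorusMollifier
import Literature.Analysis.FunctionSpaces.TorusSpaceTime

/-!
# Glueing the exact implosion into the exterior periodic solution: the glued fields

Helper file for the support item `TypeOneIdealImplosion` (stmt-AtomisticToContinuum-15146) of the
route `ImplosionDichotomy` (`AtomisticToContinuum/HydrodynamicLimit`). Last construction step of
the transplant of the self-similar implosion of the monatomic gas to `𝕋³` (Cao-Labora–Gómez-
Serrano–Shi–Staffilani, Rem. 1.5): the exact solution `E = (ρ_E, u_E)` on `[0, T) × ℝ³`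
(`Literature.Analysis.FluidPDE.CaolaboraEtAl2025.exactSolution_of_profile`) is placed at `0 ∈ 𝕋³`
inside the ball `|y| < 1/8` of the fundamental cell and the exterior solution `τ = (ρ_τ, u_τ)`
(a classical isentropic solution on `[0, T) × 𝕋³` which AGREES with `E` on the annulus
`1/16 ≤ |y| ≤ 1/8` for all times) is kept outside:

  `ρ₁(t) = ρ_τ(t) + transplant(ψ · (ρ_E(t) − lift ρ_τ(t)))`, same for `u₁`,

with a plateau `ψ = 1` on `|w| ≤ 3/32`, `ψ = 0` on `|w| ≥ 1/8` (`Torus.transplant` places a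
profile supported in `B(0, 1/4)` at `0 ∈ 𝕋³`). This file proves the LOCAL STRUCTURE of the glued
fields: near every point of `ℝ³` the lift of `ρ₁(t)` is, for all times at once, either a lattice
translate of `ρ_E(t)` or the lift of `ρ_τ(t)` (`glue_local_core`, `glue_local_exterior`), the
glued fields are jointly smooth on `[0, T) × 𝕋³` (`isSmoothSpaceTimeOn_glue`), and their values
(`glue_apply_core`, `glue_apply_exterior`). The verification of the Euler equations is in the
companion file `…TypeOneGlueSolution`. Folklore bookkeeping; tree tools `Torus.transplant`,
`Torus.reprc`, `Torus.transplant_proj_of_norm_lt`, `Torus.reprc_proj_of_norm_lt`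
(`TorusMollifier`).
-/

noncomputable section

namespace Summit.AtomisticToContinuum.HydrodynamicLimit.Theorems

open Set Filter Topology Metric Function
open scoped ContDiff
open Literature.MathematicalPhysics.KineticTheory
open Literature.Analysis.FunctionSpaces Literature.Analysis.FunctionSpaces.Torus

/-! ## The transplant on an explicit ball -/

/-- **Dichotomy for centred representatives** (the geometric core of
`Torus.transplant_proj_eventuallyEq`, with the explicit radius `1/4`): for `dist y y₀ < 1/4`,
either `reprc (proj y) = y − m`, `m = y₀ − reprc (proj y₀)`, or both `reprc (proj y)` and
`y − m` have a coordinate of modulus `≥ 1/4`. [folklore] -/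
-- adapted from Literature/Analysis/FunctionSpaces/TorusMollifier.lean (`transplant_proj_eventuallyEq`)
theorem reprc_proj_dichotomy (y₀ : V3) {y : V3} (hy : dist y y₀ < 1 / 4) :
    reprc (proj y) = y - (y₀ - reprc (proj y₀)) ∨
      ((∃ i, 1 / 4 ≤ |reprc (proj y) i|) ∧ ∃ i, 1 / 4 ≤ |(y - (y₀ - reprc (proj y₀))) i|) := by
  set w₀ := reprc (proj y₀) with hw₀
  set w := reprc (proj y) with hw
  have hproj : proj w = proj (y - (y₀ - w₀)) := by
    rw [hw, proj_reprc,
      show ∀ a b : V3, proj (a - b) = proj a - proj b from fun _ _ => rfl,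
      show ∀ a b : V3, proj (a - b) = proj a - proj b from fun _ _ => rfl,
      hw₀, proj_reprc, sub_self, sub_zero]
  by_cases heq : w = y - (y₀ - w₀)
  · exact Or.inl heq
  · right
    have hne : ∃ i, w i ≠ (y - (y₀ - w₀)) i := by
      by_contra hall
      exact heq (PiLp.ext fun i => not_not.1 (not_exists.1 hall i))
    obtain ⟨i, hi⟩ := hne
    obtain ⟨n, hn⟩ := exists_int_eq_sub_of_proj_eq hproj i
    have hn0 : n ≠ 0 := by
      rintro rfl
      exact hi (by simpa [sub_eq_zero] using hn.symm)
    have hn1 : (1 : ℝ) ≤ |(n : ℝ)| := by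
      rw [← Int.cast_abs]
      exact_mod_cast Int.one_le_abs hn0
    have hwi := reprc_apply_mem_Ico (proj y) i
    have hw₀i := reprc_apply_mem_Ico (proj y₀) i
    rw [← hw] at hwi
    rw [← hw₀] at hw₀i
    have hyi : |(y - y₀) i| < 1 / 4 :=
      (abs_apply_le_norm (y - y₀) i).trans_lt (by simpa [dist_eq_norm] using hy)
    simp only [PiLp.sub_apply, mem_Ico] at hn hwi hw₀i hyi
    rw [abs_lt] at hyi
    refine ⟨⟨i, ?_⟩, ⟨i, ?_⟩⟩
    · rcases le_or_gt 0 (n : ℝ) with hn' | hn'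
      · rw [abs_of_nonneg hn'] at hn1
        rw [le_abs]; left; linarith
      · rw [abs_of_neg hn'] at hn1
        rw [le_abs]; right; linarith
    · simp only [PiLp.sub_apply]
      rcases le_or_gt 0 (n : ℝ) with hn' | hn'
      · rw [abs_of_nonneg hn'] at hn1
        rw [le_abs]; right; linarith
      · rw [abs_of_neg hn'] at hn1
        rw [le_abs]; left; linarith

/-- **The transplant on the explicit ball `B(y₀, 1/4)`**: for a profile supported in `B(0, 1/4)`,
`transplant g (proj y) = g (y − m)`, `m = y₀ − reprc (proj y₀)`, whenever `dist y y₀ < 1/4`.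
[folklore] -/
theorem transplant_proj_eq_of_dist_lt {F : Type*} [Zero F] {g : V3 → F}
    (hg : support g ⊆ ball 0 (1 / 4)) (y₀ : V3) {y : V3} (hy : dist y y₀ < 1 / 4) :
    transplant g (proj y) = g (y - (y₀ - reprc (proj y₀))) := by
  have hg' : ∀ v : V3, (∃ i, 1 / 4 ≤ |v i|) → g v = 0 := by
    rintro v ⟨i, hi⟩
    refine notMem_support.1 fun h => ?_
    have h' := mem_ball_zero_iff.1 (hg h)
    linarith [abs_apply_le_norm v i]
  rcases reprc_proj_dichotomy y₀ hy with h | ⟨h1, h2⟩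
  · rw [transplant_apply, h]
  · rw [transplant_apply, hg' _ h1, hg' _ h2]

/-- The lattice vector `m = y₀ − reprc (proj y₀)` is invisible to `proj`: `proj (y − m) = proj y`.
[folklore] -/
theorem proj_sub_latticeShift (y₀ y : V3) : proj (y - (y₀ - reprc (proj y₀))) = proj y := by
  rw [show ∀ a b : V3, proj (a - b) = proj a - proj b from fun _ _ => rfl,
    show ∀ a b : V3, proj (a - b) = proj a - proj b from fun _ _ => rfl, proj_reprc, sub_self,
    sub_zero]

/-! ## The plateau and the glued fields -/

/-- **The glue plateau**: smooth `ψ : ℝ³ → [0, 1]`, `ψ = 1` on `|w| ≤ 3/32`, `ψ = 0` on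
`|w| ≥ 1/8`; in particular `support (ψ · h) ⊆ B(0, 1/4)` for every `h`. [folklore] -/
theorem exists_glue_plateau :
    ∃ ψ : V3 → ℝ, ContDiff ℝ ∞ ψ ∧ (∀ w, ‖w‖ ≤ 3 / 32 → ψ w = 1) ∧ (∀ w, 1 / 8 ≤ ‖w‖ → ψ w = 0) := by
  obtain ⟨χ, hχ, hχ0, hχ1, -⟩ :=
    Literature.Analysis.FluidPDE.CaolaboraEtAl2025.exists_radial_cutoff (a := 3 / 32) (b := 1 / 8)
      (by norm_num) (by norm_num)
  exact ⟨fun w => 1 - χ w, contDiff_const.sub hχ, fun w hw => by simp only [hχ0 w hw, sub_zero],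
    fun w hw => by simp only [hχ1 w hw, sub_self]⟩

section Glue

variable {F : Type*} [NormedAddCommGroup F] [NormedSpace ℝ F]
variable {T : ℝ} {ψ : V3 → ℝ} {fE : ℝ → V3 → F} {fτ : ℝ → T3 → F}

/-- Support of the glue profile `w ↦ ψ(w) (f_E(t, w) − f_τ(t, proj w))` lies in `B(0, 1/4)`.
[folklore] -/
theorem support_glueProfile_subset (hψ0 : ∀ w, 1 / 8 ≤ ‖w‖ → ψ w = 0) (t : ℝ) :
    support (fun w => ψ w • (fE t w - fτ t (proj w))) ⊆ ball (0 : V3) (1 / 4) := by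
  intro w hw
  rw [mem_ball_zero_iff]
  by_contra h
  exact hw (by simp only [hψ0 w (by linarith [not_lt.1 h]), zero_smul])

/-- **Local formula for the glued field on `B(y₀, 1/4)`**, valid for all times at once:
`lift ρ₁(t)(y) = lift ρ_τ(t)(y) + ψ(y − m)(ρ_E(t, y − m) − lift ρ_τ(t)(y))`. [folklore] -/
theorem glue_local (hψ0 : ∀ w, 1 / 8 ≤ ‖w‖ → ψ w = 0) (y₀ : V3) {y : V3} (hy : dist y y₀ < 1 / 4)
    (t : ℝ) :
    fτ t (proj y) + transplant (fun w => ψ w • (fE t w - fτ t (proj w))) (proj y) =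
      fτ t (proj y) + ψ (y - (y₀ - reprc (proj y₀))) •
        (fE t (y - (y₀ - reprc (proj y₀))) - fτ t (proj y)) := by
  rw [transplant_proj_eq_of_dist_lt (support_glueProfile_subset hψ0 t) y₀ hy, proj_sub_latticeShift]

/-- **Core points.** If the exterior field agrees with `f_E` on the annulus `1/16 ≤ |w| ≤ 1/8`
(for times in `S`), then on the ball `dist y y₀ < 1/8 − |reprc(proj y₀)|` (non-empty when
`|reprc (proj y₀)| < 1/8`) the glued field is the translate `f_E(t, y − m)` for all `t ∈ S`.
[folklore] -/
theorem glue_local_core {S : Set ℝ} (hψ1 : ∀ w, ‖w‖ ≤ 3 / 32 → ψ w = 1)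
    (hψ0 : ∀ w, 1 / 8 ≤ ‖w‖ → ψ w = 0)
    (hagree : ∀ t ∈ S, ∀ w : V3, 1 / 16 ≤ ‖w‖ → ‖w‖ ≤ 1 / 8 → fτ t (proj w) = fE t w)
    (y₀ : V3) {y : V3} (hy : dist y y₀ < 1 / 8 - ‖reprc (proj y₀)‖) {t : ℝ} (ht : t ∈ S) :
    fτ t (proj y) + transplant (fun w => ψ w • (fE t w - fτ t (proj w))) (proj y) =
      fE t (y - (y₀ - reprc (proj y₀))) := by
  set m : V3 := y₀ - reprc (proj y₀) with hm
  have hy4 : dist y y₀ < 1 / 4 := by linarith [norm_nonneg (reprc (proj y₀))]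
  rw [glue_local hψ0 y₀ hy4 t]
  -- `|y - m| < 1/8`
  have hym : ‖y - m‖ < 1 / 8 := by
    have h1 : y - m = reprc (proj y₀) + (y - y₀) := by rw [hm]; abel
    rw [h1]
    calc ‖reprc (proj y₀) + (y - y₀)‖ ≤ ‖reprc (proj y₀)‖ + ‖y - y₀‖ := norm_add_le _ _
      _ < 1 / 8 := by rw [← dist_eq_norm]; linarith
  by_cases hcase : ‖y - m‖ ≤ 3 / 32
  · rw [hψ1 _ hcase, one_smul, add_sub_cancel]
  · -- in the annulus the two fields agree
    have hann : fτ t (proj (y - m)) = fE t (y - m) := hagree t ht _ (by linarith [not_le.1 hcase]) hym.le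
    rw [proj_sub_latticeShift] at hann
    rw [hann, sub_self, smul_zero, add_zero]

/-- **Exterior points.** If the exterior field agrees with `f_E` on the annulus, then on the ball
`dist y y₀ < |reprc(proj y₀)| − 3/32` (non-empty when `|reprc (proj y₀)| > 3/32`; also `< 1/4`)
the glued field is the exterior field, for all `t ∈ S`. [folklore] -/
theorem glue_local_exterior {S : Set ℝ} (hψ0 : ∀ w, 1 / 8 ≤ ‖w‖ → ψ w = 0)
    (hagree : ∀ t ∈ S, ∀ w : V3, 1 / 16 ≤ ‖w‖ → ‖w‖ ≤ 1 / 8 → fτ t (proj w) = fE t w)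
    (y₀ : V3) {y : V3} (hy : dist y y₀ < ‖reprc (proj y₀)‖ - 3 / 32) (hy4 : dist y y₀ < 1 / 4)
    {t : ℝ} (ht : t ∈ S) :
    fτ t (proj y) + transplant (fun w => ψ w • (fE t w - fτ t (proj w))) (proj y) = fτ t (proj y) := by
  set m : V3 := y₀ - reprc (proj y₀) with hm
  rw [glue_local hψ0 y₀ hy4 t]
  -- `|y - m| > 3/32`
  have hym : 3 / 32 < ‖y - m‖ := by
    have h1 : y - m = reprc (proj y₀) + (y - y₀) := by rw [hm]; abel
    rw [h1]
    have := norm_sub_norm_le (reprc (proj y₀)) (-(y - y₀))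
    rw [sub_neg_eq_add, norm_neg, ← dist_eq_norm] at this
    linarith
  by_cases hcase : 1 / 8 ≤ ‖y - m‖
  · rw [hψ0 _ hcase, zero_smul, add_zero]
  · have hann : fτ t (proj (y - m)) = fE t (y - m) := hagree t ht _ (by linarith) (not_le.1 hcase).le
    rw [proj_sub_latticeShift] at hann
    rw [hann, sub_self, smul_zero, add_zero]

/-- **Joint smoothness of the glued field.** If `f_τ` is jointly smooth on `S × 𝕋³`, `f_E` is
jointly smooth on `S × ℝ³` (as a function on `ℝ × ℝ³`, on the set `S ×ˢ univ`) and `ψ` is smooth,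
then the glued field is jointly smooth on `S × 𝕋³` (the local formula `glue_local` on balls of
radius `1/4`). [folklore] -/
theorem isSmoothSpaceTimeOn_glue {S : Set ℝ} (hψ : ContDiff ℝ ∞ ψ)
    (hψ0 : ∀ w, 1 / 8 ≤ ‖w‖ → ψ w = 0) (hτ : IsSmoothSpaceTimeOn S fτ)
    (hE : ContDiffOn ℝ ∞ (fun p : ℝ × V3 => fE p.1 p.2) (S ×ˢ univ)) :
    IsSmoothSpaceTimeOn S
      (fun t x => fτ t x + transplant (fun w => ψ w • (fE t w - fτ t (proj w))) x) := by
  unfold IsSmoothSpaceTimeOn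
  refine contDiffOn_of_locally_contDiffOn fun p hp => ?_
  obtain ⟨t₀, y₀⟩ := p
  set m : V3 := y₀ - reprc (proj y₀) with hm
  refine ⟨univ ×ˢ ball y₀ (1 / 4), isOpen_univ.prod isOpen_ball, ⟨mem_univ _, mem_ball_self (by norm_num)⟩, ?_⟩
  -- on the neighbourhood the glued field is given by the local formula
  have hτ' : ContDiffOn ℝ ∞ (stLift fτ) ((S ×ˢ univ) ∩ univ ×ˢ ball y₀ (1 / 4)) :=
    ContDiffOn.mono hτ inter_subset_left
  have hE' : ContDiffOn ℝ ∞ (fun p : ℝ × V3 => fE p.1 (p.2 - m)) ((S ×ˢ univ) ∩ univ ×ˢ ball y₀ (1 / 4)) := by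
    refine (hE.comp (contDiff_fst.prodMk (contDiff_snd.sub contDiff_const)).contDiffOn ?_).mono
      inter_subset_left
    intro p hp
    exact ⟨hp.1, mem_univ _⟩
  have hψ' : ContDiffOn ℝ ∞ (fun p : ℝ × V3 => ψ (p.2 - m)) ((S ×ˢ univ) ∩ univ ×ˢ ball y₀ (1 / 4)) :=
    (hψ.comp (contDiff_snd.sub contDiff_const)).contDiffOn
  refine ((hτ'.add (hψ'.smul (hE'.sub hτ'))).congr fun p hp => ?_)
  obtain ⟨t, y⟩ := p
  have hy : dist y y₀ < 1 / 4 := (mem_prod.1 hp.2).2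
  simp only [stLift]
  exact glue_local hψ0 y₀ hy t

end Glue

end Summit.AtomisticToContinuum.HydrodynamicLimit.Theorems

end
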